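import Summits.BirchSwinnertonDyer.Rank1Residual.Additive.TameBranchFullSqueezeLaw
import Summits.BirchSwinnertonDyer.Rank1Residual.Additive.TameBranchLambdaParityCertificate
import Summits.BirchSwinnertonDyer.Rank1Residual.Additive.TameBranchLambdaParityRankZeroCertificate
import HarnessLib

/-!
# THE FULL SQUEEZE FROM PRINT on defect 3, 4, 6 — Delbourgo 1998 Thm 1 + 2002 (A)(B)(C) + two values
# (+ one Riemann sum at rank one) + a `μ`-bound `m` + ONE BSD-side inequality ⟹ `λ(X) = λ_an` for ANY
# `λ_an`, `μ(X) = m`, `Ш(E/ℚ)[p^∞] = 0`, `ℓ_p = 1`, `ord_p Reg_p` exact, the main conjecture (G) at the pair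
# (cell `b2b-bsdres`, sub-cell additive-p2 = X3♯(G-ord)/X4♯(G-ord), gen 31; part 6)

HONEST FRAMING (cell `b2b-bsdres`, run/shared/lean/b2b/bsd-rank1-residual/, verbatim in every
file): the goal of the cell is to DELETE the COMBINATION-SHAPED residual classes of the
Birch–Swinnerton-Dyer formula for ALL analytic-rank `≤ 1` elliptic curves over `ℚ` — "full BSD
formula for every rank `≤ 1` curve in class `C`" assembled STRICTLY from published theorems — so
that the rank-`≤ 1` remainder becomes exactly the CONSTRUCTION-SHAPED classes, which are TYPED
(missing-input `Prop`s), NOT attempted. This is not "finishing BSD". Sub-cell additive-p2: the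
classes X3♯(G-ord) / X4♯(G-ord) are CONSTRUCTION-SHAPED and stay so; labels / RESIDUAL-MAP marks
UNCHANGED; nothing is booked. Theorems only; every published input is an explicit named-fact binder
(`hD` = Delbourgo 1998 Thm 1, `hC` = Delbourgo 2002 (C) = A227, `hDel`/`hDelM` = Delbourgo 2002 (A)(B),
`hGZK`, or the typed Kato half `TameBranchRatDvdAt W p`); the `μ`-bound `m` is a HYPOTHESIS (an INTEGRAL
(C) off defect 2 is not in print). No definition, no named fact, no `sorry`.

## What and why

Part 1 (`TameBranchFullSqueezeLaw`) proved the FULL squeeze per cyclotomic datum. THIS FILE states it in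
the census's currencies: §10 every defect ((M) included) via the typed Kato half + ANY tuple;
* §11 defect 3, 4, 6 at RANK ONE from PRINT + two values + ONE Riemann sum (gen 30's witness
  `exists_isTameBranchOf_firstTop_coeff_one_of_thm1_…`): for every (B)-datum, every cyclotomic datum and
  every `(m, v)` with `μ(fE) ≤ m`, `v ≤ ord_p Reg_p(E,Dh)` and
  **`m + v_p(RS(1,n₁)) + c + 1 + 2t ≤ v + ord_p ∏c`**: `λ(fE) = k` (ANY `k`), `μ(fE) = m`, `#Ш[p^∞] = 1`,
  `ord_p Reg_p = v`, every `(u, ℓ)` of clause 3 has `ℓ = 1`, `char_Λ X = (G)` with `ι G = p^{m+c}·B`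
  (`TwistPartner.exists_fullSqueeze_rankOne_of_thm1_of_two_norm_ratTwistedSymbolSum_of_riemannSum`);
* §12 defect 3, 4, 6 at RANK ZERO from PRINT + `ord_p[0]⁺_f` + two values:
  **`m + ord_p[0]⁺_f + c + 2t ≤ ord_p ∏c`** ⟹ the same (`TwistPartner.exists_fullSqueeze_rankZero_of_thm1_…`,
  `ClassX4Gord.…` with `c = 0`). Window reading: HOME `gen31/FULL-SQUEEZE-READING.md` (EVIDENCE).

References: [Delbourgo1998] Thm 1; [Delbourgo2002] Thm. (A), (B), (C) p. 40; [GreenbergLNM1716] §4;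
[GreenbergVatsal2000] p. 4; [Washington1997] §7.1; parts 1–4 of gen 31, gens 29–30. -/

set_option autoImplicit false

noncomputable section

open scoped Classical MatrixGroups ModularForm NumberField

open CongruenceSubgroup IsDedekindDomain WeierstrassCurve NumberField
  Literature.NumberTheory.EllipticCurves
  Literature.NumberTheory.EllipticCurves.ModularForms
  Literature.NumberTheory.EllipticCurves.Rank1Residual
  Literature.NumberTheory.EllipticCurves.Rank1Residual.Typed
  Literature.NumberTheory.EllipticCurves.Delbourgo2002
  Summit.BirchSwinnertonDyer.Rank1Residual.X1.MuLambda
  Summit.BirchSwinnertonDyer.Rank1Residual.X1.RankOneParitySqueeze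
  Summit.BirchSwinnertonDyer.Rank1Residual.X11a.LambdaNorm

namespace Summit.BirchSwinnertonDyer.Rank1Residual.Additive

/-! ### §10 Every defect ((M) included): the typed Kato half + ANY tuple with a first top -/

section EveryDefect

open TameBranchExtraZeros TameBranchLambdaParity TameBranchFullSqueeze

variable {W : WeierstrassCurve ℚ} [W.IsElliptic] [W.IsGloballyMinimal] {p : ℕ} [hp : Fact p.Prime]
  {N : ℕ} [NeZero N] {f : CuspForm (Gamma0 N) 2}

/-- **RANK ONE, every defect: THE FULL SQUEEZE.** `p ≠ 2` additive of type (M) or (G-ord),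
`TameBranchRatDvdAt W p`, ANY tuple `(f, ε, α, B)` with bound `p^c`, FIRST TOP at `n`, `[T¹]B ≠ 0`,
`rank_ℤ E(ℚ) = 1`, a (B)-datum; `μ(fE) ≤ m`, `v ≤ ord_p Reg_p(E,Dh)` and
**`m + v_p([T¹]B) + c + 1 + 2·ord_p #tors ≤ v + ord_p ∏c_ℓ`**. Then `X` is torsion, Schneider,
**`λ(fE) = n`, `μ(fE) = m`, `#Ш(E/ℚ)[p^∞] = 1`, `ord_p Reg_p(E,Dh) = v`**, every `(u, ℓ)` of clause 3 has
`ℓ = 1`, and **`char_Λ X = (G)`, `ι G = p^{m+c}·B`**. [cite: Delbourgo2002, Theorem (A), (B), (C) (p. 40)]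
[cite: GreenbergLNM1716, §4 pp. 102–110] [cite: Washington1997, §7.1] -/
theorem fullSqueeze_rankOne_of_tameBranchRatDvdAt_of_firstTop (hT : TameBranchRatDvdAt W p)
    {ε : DirichletCharacter ℂ_[p] p} {α : ℚ_[p]} {B : PowerSeries ℚ_[p]}
    (hp2 : p ≠ 2) (hadd : Addv W p) (hloc : PotMult W p ∨ TypeGOrd W p)
    (hf : IsNewformOf W f) (hε : orderOf ε = tameDefect W p) (hα : ‖α‖ = 1)
    (hB : IsTameBranchOf f p ε α B) {c : ℕ} (hbd : ∀ j : ℕ, ‖PowerSeries.coeff j B‖ ≤ (p : ℝ) ^ c)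
    {n : ℕ} (hn : ‖PowerSeries.coeff n B‖ = (p : ℝ) ^ c)
    (hlt : ∀ i < n, ‖PowerSeries.coeff i B‖ < (p : ℝ) ^ c) (hB1 : PowerSeries.coeff 1 B ≠ 0)
    (hr1 : W.mordellWeilRank = 1) {Dh : PAdicHeightData W p} (hBcl : LeadingTermClauses W p Dh)
    {κ : ZpExtension ℚ p} {γ : Field.absoluteGaloisGroup ℚ}
    (hκ : κ.IsCyclotomic) (hγ : κ.IsTopGenerator γ) (hγ' : IsCyclotomicVariable p γ)
    (D : W.SelmerDualData κ γ) [Module.Finite (IwasawaAlgebra p) D.X]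
    {fE : IwasawaAlgebra p} (hchar : D.charIdeal = Ideal.span {fE})
    {m : ℕ} (hμ : mu fE ≤ m) {v : ℤ} (hv : v ≤ (padicRegulator Dh).valuation)
    (hfull : (m : ℤ) + (PowerSeries.coeff 1 B).valuation + c + 1 + 2 * padicValNat p W.torsionOrder ≤
      v + padicValNat p W.tamagawaProduct) :
    D.IsTorsion ∧ SchneiderConjecture Dh ∧ lam fE = n ∧ mu fE = m ∧
      Nat.card (AddCommGroup.primaryComponent W.sha p) = 1 ∧ (padicRegulator Dh).valuation = v ∧
      (∀ (u : ℤ_[p]ˣ) (ℓ : ℕ), ℓ ∣ p ^ 2 →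
        ((PowerSeries.coeff W.mordellWeilRank fE : ℤ_[p]) : ℚ_[p]) *
            padicLog p (cyclotomicGenerator p) ^ W.mordellWeilRank * (W.torsionOrder : ℚ_[p]) ^ 2 =
          ((u : ℤ_[p]) : ℚ_[p]) * (ℓ : ℚ_[p]) *
            ((Nat.card (AddCommGroup.primaryComponent W.sha p) : ℚ_[p]) *
              padicRegulator Dh * W.tamagawaProduct) → ℓ = 1) ∧
      ∃ G : IwasawaAlgebra p, D.charIdeal = Ideal.span {G} ∧ mu G = m ∧ lam G = n ∧
        iwasawaToPowerSeries p G = PowerSeries.C ((p : ℚ_[p]) ^ (m + c)) * B := by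
  obtain ⟨hX, g, hg, k, hι⟩ := hT ε α B hp2 hadd hloc hκ hγ hγ' hf hε hα hB D
  obtain ⟨hS, hlam, hμm, hcard, hReg, -, hℓ, hG⟩ := fullSqueeze_rankOne_of_iota_eq_of_firstTop hp2 hr1 hBcl
    hκ hγ hγ' D hX hchar hg hι hbd hn hlt hB1 hμ hv hfull
  exact ⟨hX, hS, hlam, hμm, hcard, hReg, hℓ, hG⟩

/-- **RANK ZERO, every defect: THE FULL SQUEEZE.** The typed Kato half, ANY tuple with first top at `n`,
`[0]⁺_f ≠ 0` (`B(0) = α⁻¹[0]⁺_f`), `rank_ℤ E(ℚ) = 0`, a (B)-datum; `μ(fE) ≤ m` and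
**`m + ord_p[0]⁺_f + c + 2·ord_p #tors ≤ ord_p ∏c_ℓ`**. Then `X` is torsion, **`λ(fE) = n`, `μ(fE) = m`,
`#Ш(E/ℚ)[p^∞] = 1`**, every `(u, ℓ)` of clause 3 has `ℓ = 1`, and **`char_Λ X = (G)`, `ι G = p^{m+c}·B`**.
[cite: Delbourgo2002, Theorem (A), (B), (C) (p. 40)] [cite: GreenbergLNM1716, §4 pp. 102–110]
[cite: Washington1997, §7.1] -/
theorem fullSqueeze_rankZero_of_tameBranchRatDvdAt_of_firstTop (hT : TameBranchRatDvdAt W p)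
    {ε : DirichletCharacter ℂ_[p] p} {α : ℚ_[p]} {B : PowerSeries ℚ_[p]}
    (hp2 : p ≠ 2) (hadd : Addv W p) (hloc : PotMult W p ∨ TypeGOrd W p)
    (hf : IsNewformOf W f) (hε : orderOf ε = tameDefect W p) (hα : ‖α‖ = 1)
    (hB : IsTameBranchOf f p ε α B) {c : ℕ} (hbd : ∀ j : ℕ, ‖PowerSeries.coeff j B‖ ≤ (p : ℝ) ^ c)
    {n : ℕ} (hn : ‖PowerSeries.coeff n B‖ = (p : ℝ) ^ c)
    (hlt : ∀ i < n, ‖PowerSeries.coeff i B‖ < (p : ℝ) ^ c) (h0 : ratPlusSymbol f 0 ≠ 0)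
    (hr0 : W.mordellWeilRank = 0) {Dh : PAdicHeightData W p} (hBcl : LeadingTermClauses W p Dh)
    {κ : ZpExtension ℚ p} {γ : Field.absoluteGaloisGroup ℚ}
    (hκ : κ.IsCyclotomic) (hγ : κ.IsTopGenerator γ) (hγ' : IsCyclotomicVariable p γ)
    (D : W.SelmerDualData κ γ) [Module.Finite (IwasawaAlgebra p) D.X]
    {fE : IwasawaAlgebra p} (hchar : D.charIdeal = Ideal.span {fE}) {m : ℕ} (hμ : mu fE ≤ m)
    (hfull : (m : ℤ) + padicValRat p (ratPlusSymbol f 0) + c + 2 * padicValNat p W.torsionOrder ≤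
      padicValNat p W.tamagawaProduct) :
    D.IsTorsion ∧ lam fE = n ∧ mu fE = m ∧ Nat.card (AddCommGroup.primaryComponent W.sha p) = 1 ∧
      (∀ (u : ℤ_[p]ˣ) (ℓ : ℕ), ℓ ∣ p ^ 2 →
        ((PowerSeries.coeff W.mordellWeilRank fE : ℤ_[p]) : ℚ_[p]) *
            padicLog p (cyclotomicGenerator p) ^ W.mordellWeilRank * (W.torsionOrder : ℚ_[p]) ^ 2 =
          ((u : ℤ_[p]) : ℚ_[p]) * (ℓ : ℚ_[p]) *
            ((Nat.card (AddCommGroup.primaryComponent W.sha p) : ℚ_[p]) *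
              padicRegulator Dh * W.tamagawaProduct) → ℓ = 1) ∧
      ∃ G : IwasawaAlgebra p, D.charIdeal = Ideal.span {G} ∧ mu G = m ∧ lam G = n ∧
        iwasawaToPowerSeries p G = PowerSeries.C ((p : ℚ_[p]) ^ (m + c)) * B := by
  obtain ⟨hX, g, hg, k, hι⟩ := hT ε α B hp2 hadd hloc hκ hγ hγ' hf hε hα hB D
  have h0Q : ((ratPlusSymbol f 0 : ℚ) : ℚ_[p]) ≠ 0 := by exact_mod_cast h0
  have hα0 : α ≠ 0 := by intro e; rw [e, norm_zero] at hα; exact zero_ne_one hα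
  have hB0' : PowerSeries.constantCoeff B = α⁻¹ * ((ratPlusSymbol f 0 : ℚ) : ℚ_[p]) := hB.constantCoeff
  have hB0 : PowerSeries.constantCoeff B ≠ 0 := by
    rw [hB0']; exact mul_ne_zero (inv_ne_zero hα0) h0Q
  have hvB : (PowerSeries.constantCoeff B).valuation = padicValRat p (ratPlusSymbol f 0) := by
    have hαv : (α⁻¹).valuation = 0 := by
      have h1 : ‖α⁻¹‖ = (p : ℝ) ^ (0 : ℕ) := by rw [norm_inv, hα, inv_one, pow_zero]
      have := (norm_eq_pow_iff_valuation_eq (inv_ne_zero hα0) 0).mp h1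
      simpa using this
    rw [hB0', Padic.valuation_mul (inv_ne_zero hα0) h0Q, hαv, zero_add, Padic.valuation_ratCast]
  rw [← hvB] at hfull
  obtain ⟨hlam, hμm, hcard, -, hℓ, hG⟩ := fullSqueeze_rankZero_of_iota_eq_of_firstTop hp2 hr0 hBcl hκ hγ
    hγ' D hX hchar hg hι hbd hn hlt hB0 hμ hfull
  exact ⟨hX, hlam, hμm, hcard, hℓ, hG⟩

end EveryDefect

/-! ### §11 Defect 3, 4, 6 at rank one from PRINT + two values + ONE Riemann sum -/

namespace TwistPartner

open TameBranchOneValue TameBranchTwoValue TameBranchExtraZeros TameBranchLambdaParity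
  TameBranchFullSqueeze

section JoinOne

variable {W : WeierstrassCurve ℚ} [W.IsElliptic] [W.IsGloballyMinimal] {p : ℕ} [hp : Fact p.Prime]
  {N : ℕ} [NeZero N] {f : CuspForm (Gamma0 N) 2} {χ : MulChar (ZMod p) ℚ_[p]} {ã : ℚ_[p]} {t : ℕ}
  {RS : ℕ → ℕ → ℚ_[p]}
  (hRS : ∀ k n : ℕ, RS k n =
      ∑ᶠ ξ : rootsOfUnity (Literature.NumberTheory.EllipticCurves.torsionOrder p) ℤ_[p],
        ∑ s : ZMod (p ^ n),
        twistPartnerMeasure (χ ^ t)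
            (TwistPartner.forced (χ ^ t) (fun r ↦ ((ratPlusSymbol f r : ℚ) : ℚ_[p])) ã) ã
            ((ratPlusSymbol f 0 : ℚ) : ℚ_[p]) (n + cyclotomicExponent p)
            (PadicInt.toZModPow (n + cyclotomicExponent p) ((ξ : ℤ_[p]ˣ) : ℤ_[p]) *
              (cyclotomicGenerator p : ZMod (p ^ (n + cyclotomicExponent p))) ^ s.val) *
          ((s.val.choose k : ℕ) : ℚ_[p]))

include hRS

/-- **`ord_{s=1}L(E,s) = 1`, defect 3, 4, 6, ANY `λ_an = k` — THE FULL SQUEEZE FROM PRINT + TWO VALUES +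
ONE RIEMANN SUM** (hypotheses of gen 30's `exists_sandwich_rankOne_of_thm1_…`). THE branch `B` exists
(first top `k`, `v_p([T¹]B) = v_p(RS(1,n₁))`), a (B)-datum exists, and for EVERY (B)-datum `Dh`, every
cyclotomic datum with generator `fE` and every `(m, v)` with `μ(fE) ≤ m`, `v ≤ ord_p Reg_p(E,Dh)` and
**`m + v_p(RS(1,n₁)) + c + 1 + 2·ord_p #tors ≤ v + ord_p ∏c_ℓ`**: `X` torsion, Schneider, **`λ(fE) = k`,
`μ(fE) = m`, `#Ш(E/ℚ)[p^∞] = 1`, `ord_p Reg_p(E,Dh) = v`**, every `(u, ℓ)` of clause 3 has **`ℓ = 1`**, and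
**`char_Λ X = (G)`, `ι G = p^{m+c}·B`** — the main conjecture (G) at the pair, no parity, any `λ_an`.
[cite: Delbourgo1998, Theorem 1 (p. 131)] [cite: Delbourgo2002, Theorem (A), (B), (C) (p. 40)]
[cite: GreenbergLNM1716, §4 pp. 102–110] [cite: SteinWuthrich2013, §3] [cite: Washington1997, §7.1] -/
theorem exists_fullSqueeze_rankOne_of_thm1_of_two_norm_ratTwistedSymbolSum_of_riemannSum
    (hD : Delbourgo1998.thm1_exists_bounded_evenMeasure)
    (hC : Delbourgo2002.thmC_charIdeal_dvd_tameBranch) (hDel : Delbourgo2002.mainTheorem)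
    (hDelM : Delbourgo2002.mainTheorem_potMult) (hGZK : rank_eq_analyticRank_of_analyticRank_le_one)
    (h5 : 5 ≤ p) (hcm : ¬ W.HasCM) (hadd : Addv W p) (hGord : TypeGOrd W p)
    (he : semistabilityIndex W p ∈ ({3, 4, 6} : Finset ℕ)) (hr : W.analyticRank = 1)
    (hf : IsNewformOf W f)
    {L : Type} [Field L] [NumberField L] [IsCyclotomicExtension {p} ℚ L] (F : IntermediateField ℚ L)
    (hF : ∀ w : HeightOneSpectrum (𝓞 F), (p : 𝓞 F) ∈ w.asIdeal →
      (W.baseChange F).HasGoodReductionAt w ∧ (W.baseChange F).HasUnitRootAt w)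
    (w : HeightOneSpectrum (𝓞 F)) (hw : (p : 𝓞 F) ∈ w.asIdeal)
    (hã : ‖ã‖ = 1) (hroot : ã ^ 2 - (((W.baseChange F).frobeniusTraceAt w : ℤ) : ℚ_[p]) * ã + p = 0)
    (hχe : orderOf χ = semistabilityIndex W p) {u : ℕ} (hu : semistabilityIndex W p * u = p - 1)
    (hteich : ∀ a : ZMod p, a ≠ 0 → ‖χ a - ((a.val : ℕ) : ℚ_[p]) ^ u‖ < 1) {c : ℕ}
    (hc : ∀ (m : ℕ) (a : ℤ), ‖((ratPlusSymbol f ((a : ℚ) / (p : ℚ) ^ m) : ℚ) : ℚ_[p])‖ ≤ (p : ℝ) ^ c)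
    {n : ℕ} {κ : DirichletCharacter ℂ_[p] (p ^ (n + 1 + cyclotomicExponent p))} (hκ : κ.IsPrimitive)
    (heven : κ.Even) (hord : ∃ j : ℕ, orderOf κ = p ^ j)
    {κ' : DirichletCharacter ℂ_[p] (p ^ (n + 1 + 1 + cyclotomicExponent p))} (hκ' : κ'.IsPrimitive)
    (heven' : κ'.Even) (hord' : ∃ j : ℕ, orderOf κ' = p ^ j) {k : ℕ}
    (ht : t = 1 ∨ t = semistabilityIndex W p - 1)
    (hk2 : semistabilityIndex W p * k < 2 * Nat.totient (p ^ (n + 1)))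
    (hval : ‖ratTwistedSymbolSum f κ‖ ^ (semistabilityIndex W p * Nat.totient (p ^ (n + 1))) =
      ((p : ℝ) ^ c) ^ (semistabilityIndex W p * Nat.totient (p ^ (n + 1))) *
        ((p : ℝ)⁻¹) ^ (semistabilityIndex W p * k + t * Nat.totient (p ^ (n + 1))))
    (hval' : ‖ratTwistedSymbolSum f κ'‖ ^ (semistabilityIndex W p * Nat.totient (p ^ (n + 1 + 1))) =
      ((p : ℝ) ^ c) ^ (semistabilityIndex W p * Nat.totient (p ^ (n + 1 + 1))) *
        ((p : ℝ)⁻¹) ^ (semistabilityIndex W p * k + t * Nat.totient (p ^ (n + 1 + 1))))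
    {n₁ : ℕ} (hlt : (p : ℝ) ^ c * (p : ℝ) ^ (-(n₁ : ℤ)) < ‖RS 1 n₁‖) :
    ∃ B : PowerSeries ℚ_[p],
      IsTameBranchOf f p ((χ ^ t).ringHomComp (algebraMap ℚ_[p] ℂ_[p])) ã B ∧
      ‖PowerSeries.coeff k B‖ = (p : ℝ) ^ c ∧ (∀ i < k, ‖PowerSeries.coeff i B‖ < (p : ℝ) ^ c) ∧
      (PowerSeries.coeff 1 B).valuation = (RS 1 n₁).valuation ∧
    (∃ Dh : PAdicHeightData W p, LeadingTermClauses W p Dh) ∧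
    ∀ Dh : PAdicHeightData W p, LeadingTermClauses W p Dh →
      ∀ (K : ZpExtension ℚ p) (γ : Field.absoluteGaloisGroup ℚ),
        K.IsCyclotomic → K.IsTopGenerator γ → IsCyclotomicVariable p γ →
        ∀ (D : W.SelmerDualData K γ) (fE : IwasawaAlgebra p), D.charIdeal = Ideal.span {fE} →
          ∀ (m : ℕ) (v : ℤ), X1.MuLambda.mu fE ≤ m → v ≤ (padicRegulator Dh).valuation →
            (m : ℤ) + (RS 1 n₁).valuation + c + 1 + 2 * padicValNat p W.torsionOrder ≤
              v + padicValNat p W.tamagawaProduct →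
            D.IsTorsion ∧ SchneiderConjecture Dh ∧ X1.MuLambda.lam fE = k ∧ X1.MuLambda.mu fE = m ∧
              Nat.card (AddCommGroup.primaryComponent W.sha p) = 1 ∧
              (padicRegulator Dh).valuation = v ∧
              (∀ (u' : ℤ_[p]ˣ) (ℓ : ℕ), ℓ ∣ p ^ 2 →
                ((PowerSeries.coeff W.mordellWeilRank fE : ℤ_[p]) : ℚ_[p]) *
                    padicLog p (cyclotomicGenerator p) ^ W.mordellWeilRank *
                      (W.torsionOrder : ℚ_[p]) ^ 2 =
                  ((u' : ℤ_[p]) : ℚ_[p]) * (ℓ : ℚ_[p]) *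
                    ((Nat.card (AddCommGroup.primaryComponent W.sha p) : ℚ_[p]) *
                      padicRegulator Dh * W.tamagawaProduct) → ℓ = 1) ∧
              ∃ G : IwasawaAlgebra p, D.charIdeal = Ideal.span {G} ∧
                iwasawaToPowerSeries p G = PowerSeries.C ((p : ℚ_[p]) ^ (m + c)) * B := by
  have hp2 : p ≠ 2 := by omega
  have hT : TameBranchRatDvdAt W p := tameBranchRatDvdAt_of_thmC hC hDel hDelM h5 hcm
  obtain ⟨B, hB, hordε, hbdB, hfk, hflt, hne, hvaleq⟩ :=
    exists_isTameBranchOf_firstTop_coeff_one_of_thm1_of_two_norm_ratTwistedSymbolSum_of_riemannSum hRS hD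
      h5 hadd hGord he hf F hF w hw hã hroot hχe hu hteich hc hκ heven hord hκ' heven' hord' ht hk2 hval
      hval' hlt
  obtain ⟨hmw, -⟩ := hGZK W (by rw [hr])
  have hr1 : W.mordellWeilRank = 1 := by rw [hmw, hr]
  refine ⟨B, hB, hfk, hflt, hvaleq, Delbourgo2002.mainTheorem.exists_leadingTermClauses hDel h5 hcm hadd hGord,
    fun Dh hBcl K γ hK hγ hcv D fE hchar m v hμ hv hfull ↦ ?_⟩
  haveI : Module.Finite (IwasawaAlgebra p) D.X := D.module_finite_holds hγ
  rw [← hvaleq] at hfull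
  obtain ⟨hX, hS, hlam, hμm, hcard, hReg, hℓ, G, hG, -, -, hιG⟩ :=
    fullSqueeze_rankOne_of_tameBranchRatDvdAt_of_firstTop hT hp2 hadd (Or.inr hGord) hf hordε hã hB hbdB
      hfk hflt hne hr1 hBcl hK hγ hcv D hchar hμ hv hfull
  exact ⟨hX, hS, hlam, hμm, hcard, hReg, hℓ, G, hG, hιG⟩

end JoinOne

/-! ### §12 Defect 3, 4, 6 at rank zero from PRINT + `ord_p[0]⁺_f` + two values -/

section JoinZero

open TameBranchFullSqueeze

variable {W : WeierstrassCurve ℚ} [W.IsElliptic] [W.IsGloballyMinimal] {p : ℕ} [hp : Fact p.Prime]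
  {N : ℕ} [NeZero N] {f : CuspForm (Gamma0 N) 2} {χ : MulChar (ZMod p) ℚ_[p]}

/-- **RANK ZERO, defect 3, 4, 6, ANY `λ_an = k` — THE FULL SQUEEZE FROM PRINT + `ord_p[0]⁺_f` + TWO
VALUES** (hypotheses of gen 29's `padicVal_le_rankZero_of_thm1_of_two_norm_ratTwistedSymbolSum`; `μ(fE) ≤ m`
and **`m + ord_p[0]⁺_f + c + 2·ord_p #tors ≤ ord_p ∏c_ℓ`**). A type-free witness `(ã₀, B)` with first top
`k` exists and: `X` torsion, **`λ(fE) = k`, `μ(fE) = m`, `#Ш(E/ℚ)[p^∞] = 1`**, every `(u, ℓ)` of clause 3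
has **`ℓ = 1`**, **`char_Λ X = (G)` with `ι G = p^{m+c}·B`**. [cite: Delbourgo1998, Theorem 1 (p. 131)]
[cite: Delbourgo2002, Theorem (A), (B), (C) (p. 40)] [cite: GreenbergLNM1716, §4 pp. 102–110]
[cite: Lang1990, Ch. 1 §2 Thm. 2.1] [cite: Washington1997, §7.1] -/
theorem exists_fullSqueeze_rankZero_of_thm1_of_two_norm_ratTwistedSymbolSum
    (hD : Delbourgo1998.thm1_exists_bounded_evenMeasure)
    (hC : Delbourgo2002.thmC_charIdeal_dvd_tameBranch) (hDel : Delbourgo2002.mainTheorem)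
    (hDelM : Delbourgo2002.mainTheorem_potMult) (h5 : 5 ≤ p) (hcm : ¬ W.HasCM) (hadd : Addv W p)
    (hGord : TypeGOrd W p) (he : semistabilityIndex W p ∈ ({3, 4, 6} : Finset ℕ))
    (hr0 : W.mordellWeilRank = 0) (hf : IsNewformOf W f) (hχe : orderOf χ = semistabilityIndex W p)
    {u : ℕ} (hu : semistabilityIndex W p * u = p - 1)
    (hteich : ∀ a : ZMod p, a ≠ 0 → ‖χ a - ((a.val : ℕ) : ℚ_[p]) ^ u‖ < 1) {c : ℕ}
    (hc : ∀ (m : ℕ) (a : ℤ), ‖((ratPlusSymbol f ((a : ℚ) / (p : ℚ) ^ m) : ℚ) : ℚ_[p])‖ ≤ (p : ℝ) ^ c)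
    (h0 : ratPlusSymbol f 0 ≠ 0)
    {n : ℕ} {κ : DirichletCharacter ℂ_[p] (p ^ (n + 1 + cyclotomicExponent p))} (hκ : κ.IsPrimitive)
    (heven : κ.Even) (hord : ∃ j : ℕ, orderOf κ = p ^ j)
    {κ' : DirichletCharacter ℂ_[p] (p ^ (n + 1 + 1 + cyclotomicExponent p))} (hκ' : κ'.IsPrimitive)
    (heven' : κ'.Even) (hord' : ∃ j : ℕ, orderOf κ' = p ^ j) {k t : ℕ}
    (ht : t = 1 ∨ t = semistabilityIndex W p - 1)
    (hk2 : semistabilityIndex W p * k < 2 * Nat.totient (p ^ (n + 1)))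
    (hval : ‖ratTwistedSymbolSum f κ‖ ^ (semistabilityIndex W p * Nat.totient (p ^ (n + 1))) =
      ((p : ℝ) ^ c) ^ (semistabilityIndex W p * Nat.totient (p ^ (n + 1))) *
        ((p : ℝ)⁻¹) ^ (semistabilityIndex W p * k + t * Nat.totient (p ^ (n + 1))))
    (hval' : ‖ratTwistedSymbolSum f κ'‖ ^ (semistabilityIndex W p * Nat.totient (p ^ (n + 1 + 1))) =
      ((p : ℝ) ^ c) ^ (semistabilityIndex W p * Nat.totient (p ^ (n + 1 + 1))) *
        ((p : ℝ)⁻¹) ^ (semistabilityIndex W p * k + t * Nat.totient (p ^ (n + 1 + 1))))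
    {Dh : PAdicHeightData W p} (hBcl : LeadingTermClauses W p Dh)
    {K : ZpExtension ℚ p} {γ : Field.absoluteGaloisGroup ℚ}
    (hK : K.IsCyclotomic) (hγ : K.IsTopGenerator γ) (hcv : IsCyclotomicVariable p γ)
    (D : W.SelmerDualData K γ) [Module.Finite (IwasawaAlgebra p) D.X]
    {fE : IwasawaAlgebra p} (hchar : D.charIdeal = Ideal.span {fE}) {m : ℕ} (hμ : X1.MuLambda.mu fE ≤ m)
    (hfull : (m : ℤ) + padicValRat p (ratPlusSymbol f 0) + c + 2 * padicValNat p W.torsionOrder ≤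
      padicValNat p W.tamagawaProduct) :
    ∃ (ã₀ : ℚ_[p]) (B : PowerSeries ℚ_[p]), ‖ã₀‖ = 1 ∧
      IsTameBranchOf f p ((χ ^ t).ringHomComp (algebraMap ℚ_[p] ℂ_[p])) ã₀ B ∧
      ‖PowerSeries.coeff k B‖ = (p : ℝ) ^ c ∧ (∀ i < k, ‖PowerSeries.coeff i B‖ < (p : ℝ) ^ c) ∧
      D.IsTorsion ∧ X1.MuLambda.lam fE = k ∧ X1.MuLambda.mu fE = m ∧
      Nat.card (AddCommGroup.primaryComponent W.sha p) = 1 ∧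
      (∀ (u' : ℤ_[p]ˣ) (ℓ : ℕ), ℓ ∣ p ^ 2 →
        ((PowerSeries.coeff W.mordellWeilRank fE : ℤ_[p]) : ℚ_[p]) *
            padicLog p (cyclotomicGenerator p) ^ W.mordellWeilRank * (W.torsionOrder : ℚ_[p]) ^ 2 =
          ((u' : ℤ_[p]) : ℚ_[p]) * (ℓ : ℚ_[p]) *
            ((Nat.card (AddCommGroup.primaryComponent W.sha p) : ℚ_[p]) *
              padicRegulator Dh * W.tamagawaProduct) → ℓ = 1) ∧
      ∃ G : IwasawaAlgebra p, D.charIdeal = Ideal.span {G} ∧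
        iwasawaToPowerSeries p G = PowerSeries.C ((p : ℚ_[p]) ^ (m + c)) * B := by
  have hp2 : p ≠ 2 := by omega
  have hG : SubGord W p := (subGord_iff_typeG_of_addv W p hp2 hadd).mpr hGord.typeG
  have hT : TameBranchRatDvdAt W p := tameBranchRatDvdAt_of_thmC hC hDel hDelM h5 hcm
  obtain ⟨ã₀, B, hã₀, hB, hint, hk, hlt⟩ :=
    exists_isTameBranchOf_pow_firstTop_of_thm1_of_two_norm_ratTwistedSymbolSum hD h5 hadd hGord he hf hχe hu
      hteich hc hκ heven hord hκ' heven' hord' ht hk2 hval hval'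
  have hbd : ∀ j : ℕ, ‖PowerSeries.coeff j B‖ ≤ (p : ℝ) ^ c := hint _ hc
  have hordt : orderOf (χ ^ t) = semistabilityIndex W p :=
    orderOf_pow_eq_of_mem hχe (by have := three_le_of_mem he; omega) ht
  have hordε : orderOf ((χ ^ t).ringHomComp (algebraMap ℚ_[p] ℂ_[p])) = tameDefect W p := by
    rw [orderOf_ringHomComp_padicComplex, hordt, tameDefect_of_not_potMult W p hG.1]
  obtain ⟨hX, hlam, hμm, hcard, hℓ, G', hG', -, -, hιG⟩ :=
    fullSqueeze_rankZero_of_tameBranchRatDvdAt_of_firstTop hT hp2 hadd (Or.inr hGord) hf hordε hã₀ hB hbd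
      hk hlt h0 hr0 hBcl hK hγ hcv D hchar hμ hfull
  exact ⟨ã₀, B, hã₀, hB, hk, hlt, hX, hlam, hμm, hcard, hℓ, G', hG', hιG⟩

/-- **X4♯(G-ord), defect 3, 4, 6, `rank_ℤ E(ℚ) = 0`, `p ≥ 5`, non-CM — THE FULL SQUEEZE** (`c = 0`): PRINT +
`[0]⁺_f ≠ 0` + two values + `μ(fE) ≤ m` + **`m + ord_p[0]⁺_f + 2·ord_p #tors ≤ ord_p ∏c_ℓ`** ⟹ `λ(fE) = k`,
`μ(fE) = m`, **`#Ш(E/ℚ)[p^∞] = 1`**, `char_Λ X = (G)`, **`ι G = p^m·B`** (at `m = 0`: MC (G) INTEGRALLY).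
[cite: Delbourgo1998, Theorem 1 (p. 131)] [cite: Delbourgo2002, Theorem (A), (B), (C) (p. 40)]
[cite: Manin1972, Cor. 3.6] [cite: GreenbergLNM1716, §4 pp. 102–110] [cite: Washington1997, §7.1] -/
theorem ClassX4Gord.exists_fullSqueeze_rankZero_of_thm1_of_two_norm_ratTwistedSymbolSum
    (hD : Delbourgo1998.thm1_exists_bounded_evenMeasure)
    (hC : Delbourgo2002.thmC_charIdeal_dvd_tameBranch) (hDel : Delbourgo2002.mainTheorem)
    (hDelM : Delbourgo2002.mainTheorem_potMult) (hX : ClassX4Gord W p) (h5 : 5 ≤ p) (hcm : ¬ W.HasCM)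
    (he : semistabilityIndex W p ∈ ({3, 4, 6} : Finset ℕ)) (hr0 : W.mordellWeilRank = 0)
    (hf : IsNewformOf W f) (hχe : orderOf χ = semistabilityIndex W p) {u : ℕ}
    (hu : semistabilityIndex W p * u = p - 1)
    (hteich : ∀ a : ZMod p, a ≠ 0 → ‖χ a - ((a.val : ℕ) : ℚ_[p]) ^ u‖ < 1)
    (h0 : ratPlusSymbol f 0 ≠ 0)
    {n : ℕ} {κ : DirichletCharacter ℂ_[p] (p ^ (n + 1 + cyclotomicExponent p))} (hκ : κ.IsPrimitive)
    (heven : κ.Even) (hord : ∃ j : ℕ, orderOf κ = p ^ j)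
    {κ' : DirichletCharacter ℂ_[p] (p ^ (n + 1 + 1 + cyclotomicExponent p))} (hκ' : κ'.IsPrimitive)
    (heven' : κ'.Even) (hord' : ∃ j : ℕ, orderOf κ' = p ^ j) {k t : ℕ}
    (ht : t = 1 ∨ t = semistabilityIndex W p - 1)
    (hk2 : semistabilityIndex W p * k < 2 * Nat.totient (p ^ (n + 1)))
    (hval : ‖ratTwistedSymbolSum f κ‖ ^ (semistabilityIndex W p * Nat.totient (p ^ (n + 1))) =
      ((p : ℝ)⁻¹) ^ (semistabilityIndex W p * k + t * Nat.totient (p ^ (n + 1))))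
    (hval' : ‖ratTwistedSymbolSum f κ'‖ ^ (semistabilityIndex W p * Nat.totient (p ^ (n + 1 + 1))) =
      ((p : ℝ)⁻¹) ^ (semistabilityIndex W p * k + t * Nat.totient (p ^ (n + 1 + 1))))
    {Dh : PAdicHeightData W p} (hBcl : LeadingTermClauses W p Dh)
    {K : ZpExtension ℚ p} {γ : Field.absoluteGaloisGroup ℚ}
    (hK : K.IsCyclotomic) (hγ : K.IsTopGenerator γ) (hcv : IsCyclotomicVariable p γ)
    (D : W.SelmerDualData K γ) [Module.Finite (IwasawaAlgebra p) D.X]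
    {fE : IwasawaAlgebra p} (hchar : D.charIdeal = Ideal.span {fE}) {m : ℕ} (hμ : X1.MuLambda.mu fE ≤ m)
    (hfull : (m : ℤ) + padicValRat p (ratPlusSymbol f 0) + 2 * padicValNat p W.torsionOrder ≤
      padicValNat p W.tamagawaProduct) :
    ∃ (ã₀ : ℚ_[p]) (B : PowerSeries ℚ_[p]), ‖ã₀‖ = 1 ∧
      IsTameBranchOf f p ((χ ^ t).ringHomComp (algebraMap ℚ_[p] ℂ_[p])) ã₀ B ∧
      ‖PowerSeries.coeff k B‖ = 1 ∧ (∀ i < k, ‖PowerSeries.coeff i B‖ < 1) ∧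
      D.IsTorsion ∧ X1.MuLambda.lam fE = k ∧ X1.MuLambda.mu fE = m ∧
      Nat.card (AddCommGroup.primaryComponent W.sha p) = 1 ∧
      ∃ G : IwasawaAlgebra p, D.charIdeal = Ideal.span {G} ∧
        iwasawaToPowerSeries p G = PowerSeries.C ((p : ℚ_[p]) ^ m) * B := by
  have hc : ∀ (m : ℕ) (a : ℤ),
      ‖((ratPlusSymbol f ((a : ℚ) / (p : ℚ) ^ m) : ℚ) : ℚ_[p])‖ ≤ (p : ℝ) ^ (0 : ℕ) := fun m a ↦ by
    rw [pow_zero]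
    exact plusSymbolsPIntegralAt_of_classX4 W p hX.1 f hf _
  have hval₀ : ‖ratTwistedSymbolSum f κ‖ ^ (semistabilityIndex W p * Nat.totient (p ^ (n + 1))) =
      ((p : ℝ) ^ (0 : ℕ)) ^ (semistabilityIndex W p * Nat.totient (p ^ (n + 1))) *
        ((p : ℝ)⁻¹) ^ (semistabilityIndex W p * k + t * Nat.totient (p ^ (n + 1))) := by
    rw [pow_zero, one_pow, one_mul]; exact hval
  have hval₀' : ‖ratTwistedSymbolSum f κ'‖ ^ (semistabilityIndex W p * Nat.totient (p ^ (n + 1 + 1))) =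
      ((p : ℝ) ^ (0 : ℕ)) ^ (semistabilityIndex W p * Nat.totient (p ^ (n + 1 + 1))) *
        ((p : ℝ)⁻¹) ^ (semistabilityIndex W p * k + t * Nat.totient (p ^ (n + 1 + 1))) := by
    rw [pow_zero, one_pow, one_mul]; exact hval'
  have hfull₀ : (m : ℤ) + padicValRat p (ratPlusSymbol f 0) + ((0 : ℕ) : ℤ) +
      2 * padicValNat p W.torsionOrder ≤ padicValNat p W.tamagawaProduct := by
    rw [Nat.cast_zero, add_zero]; exact hfull
  obtain ⟨ã₀, B, hã₀, hB, hk, hlt, hXt, hlam, hμm, hcard, -, G, hG, hιG⟩ :=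
    TwistPartner.exists_fullSqueeze_rankZero_of_thm1_of_two_norm_ratTwistedSymbolSum hD hC hDel hDelM h5 hcm
      hX.addv.2 hX.typeGOrd he hr0 hf hχe hu hteich hc h0 hκ heven hord hκ' heven' hord' ht hk2 hval₀ hval₀'
      hBcl hK hγ hcv D hchar hμ hfull₀
  rw [pow_zero] at hk hlt
  rw [add_zero] at hιG
  exact ⟨ã₀, B, hã₀, hB, hk, hlt, hXt, hlam, hμm, hcard, G, hG, hιG⟩

end JoinZero

end TwistPartner

end Summit.BirchSwinnertonDyer.Rank1Residual.Additive

end
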